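import Literature.NumberTheory.LFunctions.MollifierPowerSaving
import Literature.Analysis.Complex.MeanSquareThreeLines
import Literature.NumberTheory.LFunctions.ZetaLogDerivDisc
import Literature.NumberTheory.LFunctions.NymanBeurlingVectorsOrthogonal
import HarnessLib

/-!
# Convexity of the Gaussian-weighted mean square of `ζψ_X − 1` between `σ = 1/2` and `σ = 3`

Topic `Literature/NumberTheory/LFunctions`.

This is the convexity step of Selberg's density theorem near the critical line (Selberg 1942,
"Contributions …" 1946; Titchmarsh §9.24 and Theorem 9.19 (C)): the entire function

  `G(s) = G_{X,T₀,V}(s) = ((s−1)(ζ(s)ψ_X(s) − 1))/(s+1) · exp(((s − 1/2 − iT₀)/V)²)`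

(`(s−1)ζ(s)` is Mathlib's entire `riemannZeta₁`; the factor `(s−1)/(s+1)` removes the pole, the
Gaussian `exp(((s − 1/2 − iT₀)/V)²)`, of modulus `e^{((σ−1/2)² − (t−T₀)²)/V²}`, localises to
`|t − T₀| ≲ V`) is holomorphic on `Re s > −1` and dominated on `1/4 ≤ Re s ≤ 13/4` by a Gaussian
in `t`; hence, by the convexity theorem for mean squares
(`Literature.Analysis.Complex.meanSquare_le_interp`), for `1/2 ≤ σ ≤ 3`,

  `J(σ) ≤ J(1/2)^{1−θ} J(3)^θ`, `θ = (σ − 1/2)/(5/2)`, `J(σ) = ∫ |G(σ+it)|² dt`.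

* `Literature.NumberTheory.LFunctions.TwistedMoment.zetaMollifierG` — DEFINITION of `G`;
* `Literature.NumberTheory.LFunctions.TwistedMoment.zetaMollifierG_eq` — `G = (s−1)(ζψ−1)/(s+1) · E`
  off `s = 1`;
* `Literature.NumberTheory.LFunctions.TwistedMoment.norm_zetaMollifierG_le` — the Gaussian majorant;
* `Literature.NumberTheory.LFunctions.TwistedMoment.meanSquare_zetaMollifierG_le_interp` — the
  convexity inequality.

## References

* E. C. Titchmarsh, *The Theory of the Riemann Zeta-Function*, 2nd ed. (1986), §7.8, §9.19, §9.24.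
  [cite: Titchmarsh1986, §9.24]
* A. Selberg, *Contributions to the theory of the Riemann zeta-function*, Arch. Math. Naturvid. 48
  (1946), no. 5, §4.
-/

noncomputable section

open Complex Real MeasureTheory Set
open Complex.HadamardThreeLines (verticalStrip verticalClosedStrip)
open Literature.NumberTheory.LFunctions.PlateauMollifier (weight abs_weight_le_one)
open Literature.Analysis.Complex (mem_verticalClosedStrip_iff mem_verticalStrip_iff meanSquare_le_interp)

namespace Literature.NumberTheory.LFunctions.TwistedMoment

/-! ### Growth of `(s−1)ζ(s)` and of `ψ_X` in the strip -/

/-- `‖ψ_X(s)‖ ≤ X` for `Re s ≥ 0`, `X ≥ 0`. [folklore] -/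
theorem norm_plateauMollifier_le {X : ℝ} (hX : 0 ≤ X) {s : ℂ} (hs : 0 ≤ s.re) :
    ‖plateauMollifier X s‖ ≤ X := by
  rw [plateauMollifier_def]
  refine (norm_sum_le _ _).trans ?_
  calc ∑ d ∈ Finset.Icc 1 ⌊X⌋₊, ‖((weight X d : ℝ) : ℂ) * (d : ℂ) ^ (-s)‖
      ≤ ∑ d ∈ Finset.Icc 1 ⌊X⌋₊, (1 : ℝ) := by
        refine Finset.sum_le_sum fun d hd => ?_
        have hd0 : 0 < d := (Finset.mem_Icc.1 hd).1
        rw [norm_mul, Complex.norm_real, Real.norm_eq_abs, Complex.norm_natCast_cpow_of_pos hd0]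
        have h1 := abs_weight_le_one X d
        have h2 : (d : ℝ) ^ (-s).re ≤ 1 := by
          apply Real.rpow_le_one_of_one_le_of_nonpos (by exact_mod_cast hd0) (by simpa using hs)
        have h3 : 0 ≤ (d : ℝ) ^ (-s).re := Real.rpow_nonneg (Nat.cast_nonneg d) _
        nlinarith [abs_nonneg (weight X d)]
    _ = ⌊X⌋₊ := by simp
    _ ≤ X := Nat.floor_le hX

/-- `ψ_X` is entire. [folklore] -/
theorem differentiable_plateauMollifier (X : ℝ) : Differentiable ℂ (plateauMollifier X) := by
  have : plateauMollifier X = fun s => ∑ d ∈ Finset.Icc 1 ⌊X⌋₊, ((weight X d : ℝ) : ℂ) * (d : ℂ) ^ (-s) := by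
    funext s; rfl
  rw [this]
  refine Differentiable.fun_sum fun d hd => ?_
  have hd0 : (d : ℂ) ≠ 0 := by exact_mod_cast Nat.one_le_iff_ne_zero.1 (Finset.mem_Icc.1 hd).1
  exact (differentiable_id.neg.const_cpow (Or.inl hd0)).const_mul _

/-! ### The function `G` -/

/-- **`G_{X,T₀,V}(s) = ((s−1)ζ(s)ψ_X(s) − (s−1))/(s+1) · exp(((s − 1/2 − iT₀)/V)²)`**, the
regularised, Gaussian-localised `ζψ_X − 1` of the convexity argument of Titchmarsh §9.24 / Selberg's
density theorem. [cite: Titchmarsh1986, §9.24] -/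
def zetaMollifierG (X T₀ V : ℝ) (s : ℂ) : ℂ :=
  (riemannZeta₁ s * plateauMollifier X s - (s - 1)) / (s + 1) * cexp (((s - 1 / 2 - T₀ * I) / V) ^ 2)

/-- Unfolding lemma for `zetaMollifierG`. [folklore] -/
theorem zetaMollifierG_def (X T₀ V : ℝ) (s : ℂ) : zetaMollifierG X T₀ V s =
    (riemannZeta₁ s * plateauMollifier X s - (s - 1)) / (s + 1) * cexp (((s - 1 / 2 - T₀ * I) / V) ^ 2) := rfl

/-- Off `s = 1`: `G(s) = (s−1)(ζ(s)ψ_X(s) − 1)/(s+1) · exp(((s − 1/2 − iT₀)/V)²)`. [folklore] -/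
theorem zetaMollifierG_eq {X T₀ V : ℝ} {s : ℂ} (hs : s ≠ 1) : zetaMollifierG X T₀ V s =
    (s - 1) / (s + 1) * (riemannZeta s * plateauMollifier X s - 1) * cexp (((s - 1 / 2 - T₀ * I) / V) ^ 2) := by
  rw [zetaMollifierG_def, Literature.NumberTheory.LFunctions.riemannZeta₁_eq_mul hs]
  ring

/-- `G` is holomorphic on `Re s > −1`. [folklore] -/
theorem differentiableOn_zetaMollifierG (X T₀ V : ℝ) :
    DifferentiableOn ℂ (zetaMollifierG X T₀ V) {s : ℂ | -1 < s.re} := by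
  intro s hs
  have hs1 : s + 1 ≠ 0 := by
    intro h; have := congrArg Complex.re h; simp at this; simp only [Set.mem_setOf_eq] at hs; linarith
  refine DifferentiableAt.differentiableWithinAt ?_
  unfold zetaMollifierG
  refine DifferentiableAt.mul (DifferentiableAt.div ?_ (by fun_prop) hs1) (by fun_prop)
  exact ((differentiable_riemannZeta₁ s).mul (differentiable_plateauMollifier X s)).sub (by fun_prop)

/-- The modulus of the Gaussian factor. [folklore] -/
theorem norm_cexp_gaussFactor (T₀ : ℝ) {V : ℝ} (hV : 0 < V) (s : ℂ) :
    ‖cexp (((s - 1 / 2 - T₀ * I) / V) ^ 2)‖ = Real.exp (((s.re - 1 / 2) ^ 2 - (s.im - T₀) ^ 2) / V ^ 2) := by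
  rw [Complex.norm_exp]
  congr 1
  have hre : ((s - 1 / 2 - T₀ * I) / V).re = (s.re - 1 / 2) / V := by
    rw [Complex.div_ofReal_re]; congr 1; simp
  have him : ((s - 1 / 2 - T₀ * I) / V).im = (s.im - T₀) / V := by
    rw [Complex.div_ofReal_im]; congr 1; simp
  rw [sq, Complex.mul_re, hre, him]
  field_simp

/-- `y⁴ e^{-y²/2} ≤ 8`. [folklore] -/
theorem pow_four_mul_exp_neg_le (y : ℝ) : y ^ 4 * Real.exp (-(y ^ 2) / 2) ≤ 8 := by
  have h := Real.pow_div_factorial_le_exp (y ^ 2 / 2) (by positivity) 2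
  rw [Nat.factorial_two] at h
  have e : (y ^ 2 / 2) ^ 2 / (2 : ℕ) = y ^ 4 / 8 := by push_cast; ring
  rw [e] at h
  have hpos : 0 < Real.exp (y ^ 2 / 2) := Real.exp_pos _
  rw [show -(y ^ 2) / 2 = -(y ^ 2 / 2) by ring, Real.exp_neg, ← div_eq_mul_inv, div_le_iff₀ hpos]
  linarith

/-- `(1 + |w|)⁴ e^{-w²/(2V²)} ≤ 72 (1 + V)⁴` for `V > 0`. [folklore] -/
theorem one_add_abs_pow_four_mul_exp_le {w V : ℝ} (hV : 0 < V) :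
    (1 + |w|) ^ 4 * Real.exp (-(w ^ 2) / (2 * V ^ 2)) ≤ 72 * (1 + V) ^ 4 := by
  set y := |w| / V with hy
  have hy0 : 0 ≤ y := by positivity
  have hw : |w| = V * y := by rw [hy]; field_simp
  have h1 : 1 + |w| ≤ (1 + V) * (1 + y) := by rw [hw]; nlinarith
  have h2 : (1 + |w|) ^ 4 ≤ (1 + V) ^ 4 * (1 + y) ^ 4 := by
    rw [← mul_pow]; exact pow_le_pow_left₀ (by positivity) h1 4
  have h3 : (1 + y) ^ 4 ≤ 8 * (1 + y ^ 4) := by nlinarith [sq_nonneg (y - 1), sq_nonneg (y + 1), sq_nonneg y, sq_nonneg (y ^ 2 - 1)]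
  have hexp : Real.exp (-(w ^ 2) / (2 * V ^ 2)) = Real.exp (-(y ^ 2) / 2) := by
    congr 1; rw [hy, div_pow, sq_abs]; field_simp
  rw [hexp]
  have h4 := pow_four_mul_exp_neg_le y
  have hexp1 : Real.exp (-(y ^ 2) / 2) ≤ 1 := by
    rw [Real.exp_le_one_iff]; have : 0 ≤ y ^ 2 := sq_nonneg y; linarith
  have hexp0 : 0 ≤ Real.exp (-(y ^ 2) / 2) := (Real.exp_pos _).le
  calc (1 + |w|) ^ 4 * Real.exp (-(y ^ 2) / 2) ≤ ((1 + V) ^ 4 * (8 * (1 + y ^ 4))) * Real.exp (-(y ^ 2) / 2) := by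
        exact mul_le_mul_of_nonneg_right (h2.trans (mul_le_mul_of_nonneg_left h3 (by positivity))) hexp0
    _ = 8 * (1 + V) ^ 4 * (Real.exp (-(y ^ 2) / 2) + y ^ 4 * Real.exp (-(y ^ 2) / 2)) := by ring
    _ ≤ 8 * (1 + V) ^ 4 * (1 + 8) := by gcongr
    _ = 72 * (1 + V) ^ 4 := by ring

/-- **The Gaussian majorant of `G`**: for `X ≥ 1`, `V ≥ 3` and `1/4 ≤ Re s ≤ 13/4`,
`‖G(s)‖ ≤ 450 X (6 + |T₀|)⁴ (1 + V)⁴ · e^{-(Im s − T₀)²/(2V²)}`. [cite: Titchmarsh1986, §9.24] -/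
theorem norm_zetaMollifierG_le {X T₀ V : ℝ} (hX : 1 ≤ X) (hV : 3 ≤ V) {s : ℂ}
    (hs : s ∈ verticalClosedStrip (1 / 4 : ℝ) (13 / 4)) :
    ‖zetaMollifierG X T₀ V s‖ ≤
      450 * X * (6 + |T₀|) ^ 4 * (1 + V) ^ 4 * Real.exp (-(s.im - T₀) ^ 2 / (Real.sqrt 2 * V) ^ 2) := by
  obtain ⟨hs1, hs2⟩ := mem_verticalClosedStrip_iff.1 hs
  have hV0 : 0 < V := by linarith
  have hX0 : 0 ≤ X := by linarith
  -- the pieces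
  have hζ : ‖riemannZeta₁ s‖ ≤ (‖s‖ + 2) ^ 4 := Literature.NumberTheory.LFunctions.BurnolVectors.norm_riemannZeta₁_le (by linarith)
  have hψ : ‖plateauMollifier X s‖ ≤ X := norm_plateauMollifier_le hX0 (by linarith)
  have hs1' : 1 ≤ ‖s + 1‖ := by
    have := abs_re_le_norm (s + 1); rw [add_re, one_re] at this
    have h : 1 ≤ |s.re + 1| := by rw [abs_of_pos (by linarith)]; linarith
    exact h.trans this
  have hnum : ‖riemannZeta₁ s * plateauMollifier X s - (s - 1)‖ ≤ 2 * X * (‖s‖ + 2) ^ 4 := by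
    refine (norm_sub_le _ _).trans ?_
    rw [norm_mul]
    have h1 : ‖riemannZeta₁ s‖ * ‖plateauMollifier X s‖ ≤ (‖s‖ + 2) ^ 4 * X :=
      mul_le_mul hζ hψ (norm_nonneg _) (by positivity)
    have h2 : ‖s - 1‖ ≤ ‖s‖ + 2 := (norm_sub_le _ _).trans (by simp)
    have h3 : ‖s‖ + 2 ≤ X * (‖s‖ + 2) ^ 4 := by
      have hp : 2 ≤ ‖s‖ + 2 := by linarith [norm_nonneg s]
      have hp3 : 1 ≤ (‖s‖ + 2) ^ 3 := one_le_pow₀ (by linarith)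
      have h4 : (‖s‖ + 2) ≤ (‖s‖ + 2) ^ 4 := by
        calc (‖s‖ + 2) = (‖s‖ + 2) * 1 := by ring
          _ ≤ (‖s‖ + 2) * (‖s‖ + 2) ^ 3 := by gcongr
          _ = (‖s‖ + 2) ^ 4 := by ring
      have h5 : (‖s‖ + 2) ^ 4 ≤ X * (‖s‖ + 2) ^ 4 := le_mul_of_one_le_left (by positivity) hX
      linarith
    nlinarith
  have hfrac : ‖(riemannZeta₁ s * plateauMollifier X s - (s - 1)) / (s + 1)‖ ≤ 2 * X * (‖s‖ + 2) ^ 4 := by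
    rw [norm_div]
    exact (div_le_self (norm_nonneg _) hs1').trans hnum
  have hE := norm_cexp_gaussFactor T₀ hV0 s
  -- `‖s‖ + 2 ≤ 6 + |t| ≤ (6 + |T₀|)(1 + |t − T₀|)`
  set w := s.im - T₀ with hw
  have hnorm : ‖s‖ + 2 ≤ (6 + |T₀|) * (1 + |w|) := by
    have h1 : ‖s‖ ≤ |s.re| + |s.im| := Complex.norm_le_abs_re_add_abs_im s
    have h2 : |s.re| ≤ 13 / 4 := abs_le.2 ⟨by linarith, hs2⟩
    have h3 : |s.im| ≤ |T₀| + |w| := by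
      rw [hw]; have := abs_add_le T₀ (s.im - T₀); rw [add_sub_cancel] at this; exact this
    nlinarith [abs_nonneg T₀, abs_nonneg w]
  have hpow : (‖s‖ + 2) ^ 4 ≤ (6 + |T₀|) ^ 4 * (1 + |w|) ^ 4 := by
    rw [← mul_pow]; exact pow_le_pow_left₀ (by positivity) hnorm 4
  -- the Gaussian factor: `e^{((σ−1/2)² − w²)/V²} ≤ e · e^{−w²/V²}`
  have hσ : (s.re - 1 / 2) ^ 2 ≤ V ^ 2 := by nlinarith
  have hEle : Real.exp (((s.re - 1 / 2) ^ 2 - (s.im - T₀) ^ 2) / V ^ 2) ≤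
      Real.exp 1 * Real.exp (-(w ^ 2) / (2 * V ^ 2)) * Real.exp (-(w ^ 2) / (2 * V ^ 2)) := by
    rw [← Real.exp_add, ← Real.exp_add]
    refine Real.exp_le_exp.2 ?_
    rw [hw]
    have hV2 : 0 < V ^ 2 := by positivity
    rw [div_le_iff₀ hV2] at *
    have e1 : (1 + -((s.im - T₀) ^ 2) / (2 * V ^ 2) + -((s.im - T₀) ^ 2) / (2 * V ^ 2)) * V ^ 2 =
        V ^ 2 - (s.im - T₀) ^ 2 := by field_simp; ring
    rw [e1]; linarith
  -- assemble
  rw [zetaMollifierG_def, norm_mul, hE]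
  have hsq2 : (Real.sqrt 2 * V) ^ 2 = 2 * V ^ 2 := by rw [mul_pow, Real.sq_sqrt (by norm_num)]
  rw [hsq2]
  have hgauss := one_add_abs_pow_four_mul_exp_le (w := w) hV0
  have hexp0 : 0 ≤ Real.exp (-(w ^ 2) / (2 * V ^ 2)) := (Real.exp_pos _).le
  have he3 : Real.exp 1 ≤ 3 := by have := Real.exp_one_lt_d9; linarith
  calc ‖(riemannZeta₁ s * plateauMollifier X s - (s - 1)) / (s + 1)‖ *
        Real.exp (((s.re - 1 / 2) ^ 2 - (s.im - T₀) ^ 2) / V ^ 2)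
      ≤ (2 * X * ((6 + |T₀|) ^ 4 * (1 + |w|) ^ 4)) *
        (Real.exp 1 * Real.exp (-(w ^ 2) / (2 * V ^ 2)) * Real.exp (-(w ^ 2) / (2 * V ^ 2))) := by
        refine mul_le_mul (hfrac.trans (by nlinarith)) hEle (Real.exp_pos _).le (by positivity)
    _ = 2 * Real.exp 1 * X * (6 + |T₀|) ^ 4 * ((1 + |w|) ^ 4 * Real.exp (-(w ^ 2) / (2 * V ^ 2)))
        * Real.exp (-(w ^ 2) / (2 * V ^ 2)) := by ring
    _ ≤ 2 * 3 * X * (6 + |T₀|) ^ 4 * (72 * (1 + V) ^ 4) * Real.exp (-(w ^ 2) / (2 * V ^ 2)) := by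
        gcongr
    _ ≤ 450 * X * (6 + |T₀|) ^ 4 * (1 + V) ^ 4 * Real.exp (-(s.im - T₀) ^ 2 / (2 * V ^ 2)) := by
        rw [hw, show -((s.im - T₀) ^ 2) / (2 * V ^ 2) = -(s.im - T₀) ^ 2 / (2 * V ^ 2) by ring]
        have : 0 ≤ X * (6 + |T₀|) ^ 4 * (1 + V) ^ 4 * Real.exp (-(s.im - T₀) ^ 2 / (2 * V ^ 2)) := by positivity
        nlinarith

/-- **Convexity of the weighted mean square of `ζψ_X − 1`** (Titchmarsh §7.8/§9.24, Selberg): for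
`X ≥ 1`, `V ≥ 3` and `1/2 ≤ σ ≤ 3`, with `J(σ) = ∫ |G_{X,T₀,V}(σ+it)|² dt`,
`J(σ) ≤ J(1/2)^{1 − (σ−1/2)/(5/2)} J(3)^{(σ−1/2)/(5/2)}`. [cite: Titchmarsh1986, §9.24] -/
theorem meanSquare_zetaMollifierG_le_interp {X T₀ V : ℝ} (hX : 1 ≤ X) (hV : 3 ≤ V) {σ : ℝ}
    (hσ : 1 / 2 ≤ σ ∧ σ ≤ 3) :
    ∫ y : ℝ, ‖zetaMollifierG X T₀ V (σ + y * I)‖ ^ 2 ≤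
      (∫ y : ℝ, ‖zetaMollifierG X T₀ V ((1 / 2 : ℝ) + y * I)‖ ^ 2) ^ (1 - (σ - 1 / 2) / (3 - 1 / 2)) *
        (∫ y : ℝ, ‖zetaMollifierG X T₀ V ((3 : ℝ) + y * I)‖ ^ 2) ^ ((σ - 1 / 2) / (3 - 1 / 2)) := by
  have hV0 : 0 < V := by linarith
  have hG : DifferentiableOn ℂ (zetaMollifierG X T₀ V) (verticalStrip (1 / 2 - 1 / 4) (3 + 1 / 4)) := by
    refine (differentiableOn_zetaMollifierG X T₀ V).mono fun s hs => ?_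
    rw [mem_verticalStrip_iff] at hs
    simp only [Set.mem_setOf_eq]; linarith [hs.1]
  have hB : ∀ z ∈ verticalClosedStrip (1 / 2 - 1 / 4) (3 + 1 / 4), ‖zetaMollifierG X T₀ V z‖ ≤
      (450 * X * (6 + |T₀|) ^ 4 * (1 + V) ^ 4) * Real.exp (-(z.im - T₀) ^ 2 / (Real.sqrt 2 * V) ^ 2) := by
    intro z hz
    have hz' : z ∈ verticalClosedStrip (1 / 4 : ℝ) (13 / 4) := by
      rw [mem_verticalClosedStrip_iff] at hz ⊢; constructor <;> linarith [hz.1, hz.2]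
    exact norm_zetaMollifierG_le hX hV hz'
  exact meanSquare_le_interp (by norm_num) (by norm_num) (by positivity) (by positivity) hG hB hσ

end Literature.NumberTheory.LFunctions.TwistedMoment
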